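import Literature.MathematicalPhysics.QuantumFieldTheory.Balaban1983to89.B9Ineq377L2

/-!
# `Balaban1983to89.B9Ineq366L2` — [Balaban1985BackgroundPropagators] (3.66) p. 403 IN THE BLOCK-`ℓ²` CURRENCY: the printed six-term sum `C′(A)`
# (`B9Eq360Vprime.cPrime`) has `C′(A) ≺₂ κ₃₆₆·α₁·(Lʲη)⁴·e^{−ρd}` from block-`ℓ²` sizes of its building blocks — the `ℓ²` twin of r06's `B9Ineq366CPrime` §3
# (`hasMajorant_cPrime`, `hasMajorant_cPrime_half`) VERBATIM in this seat's `ℓ²` calculus; seventh brick of the kernel-free `ℓ²` route to the (3.46) members of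
# `G(U′U)` (the C-sector input of the (3.68) entries of `P′(A)`, `B9Ineq377L2.ineq368_l2`)

T. Bałaban, *Propagators for lattice gauge theories in a background field*, Commun. Math. Phys. **99** (1985) 389–434
[`Balaban1985BackgroundPropagators`, "B9"]; [4] = T. Bałaban, *Propagators and renormalization transformations for lattice gauge theories. II*,
Commun. Math. Phys. **96** (1984) 223–250 [`Balaban1984PropagatorsII`].

statement-level skeleton of published theorems with citation tags; proofs where landed; nothing here is a claim about the Yang–Mills mass gap

THE PRINTED LOCUS (verbatim, p. 403): *"C(U′U) = Q′(U′U)G′²(U′U)Q′*(U′U) = C(U) + C′(A), where C′(A) = [the six-term display] (3.65) and satisfies |C′(A; y, y′)| ≤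
O(1)α₁(Lʲη)⁴(L^{j′}η)^{−d}e^{−δ₀d(y,y′)} (3.66). The inverse satisfies Theorem 3.2."*; p. 407: *"Theorem (3.3) implies also convergence in all norms appearing in its
formulation"* — for the `L²` members of (3.46) the C-sector of the (3.68) entries of `P′(A)` is read in block-`ℓ²`.

WHY THIS FILE (pub-ymgap N06 row 13, seat dag-n06-c g5).  `B9Ineq377L2.ineq368_l2` (the (3.68) entries of `P′(A)` in `ℓ²`) takes a block-`ℓ²` size of `C′(A)`
(`κ_Cα₁(Lʲη)⁴e^{−δd}`) as input; THIS FILE produces it from the building blocks, exactly as r06's sup `hasMajorant_cPrime` — the SAME six terms and the SAME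
algebra with the `ℓ²` composition lemmas (`B9Ineq363L2.hasL2Majorant_comp_decay`, `B9Ineq377L2` §0); r06's constant `kappa366` BY NAME.  INPUTS: block-`ℓ²`
majorants of `G′(U)`, `G′(U′U)` ((3.46)₀ shapes), of `V′G′(U)` and `V′(A)·G′(U′U)`-type words (the `ℓ²` (3.63), `B9Ineq363L2`), and of the block-local letters
`Q′, Q′*` (`κ_Q𝟙`, `κ_Q ≧ 0`) and `F′₂, F′₂*` (`c_Fα₁𝟙`) read in block-`ℓ²` (instance readings).

WHAT IS PROVED (theorems only; 0 sorry; standard axioms; no definition): §1 ★★ `hasL2Majorant_cPrime`, ★ `hasL2Majorant_cPrime_half` (the same at half the input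
rate); §2 ★ `ineq349_l2_sandwich` — (3.49) in block-ℓ² for the frames' sandwiched word `G′·M·G′` with `M = Q′*(Q′G′²Q′*)⁻¹Q′` ONE letter (`B9Ineq377L2.ineq349_l2`
at `Q = Q* = 1`; `M`'s size is what `B6RandomWalkL2Hom.hasL2Majorant_sandwich` delivers).

HONEST SCOPE.  Finite-dimensional bookkeeping; every letter a binder with its size as hypothesis; nothing of [B9] asserted; count-neutral; NOT a node discharge;
nothing continuum ∕ OS ∕ mass-gap ∕ Clay.  Cell `pub-ymgap` (HUMAN RULING D-0062), Track A node N06 [B9], N06-ASSIGNMENT row 13, seat `pub-ymgap-dag-n06-c` (g5),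
2026-08-27.  NOT HERE: r06's §4–§6 (the two-space corner / `cPrimeHom` dictionary and «the inverse satisfies Theorem 3.2») — those pass through the lattice of
blocks (successor, with `B6RandomWalkL2Hom`).
-/

noncomputable section

open scoped BigOperators

namespace Literature.MathematicalPhysics.QuantumFieldTheory.Balaban1983to89.B9Ineq366L2

open Literature.MathematicalPhysics.QuantumFieldTheory.Balaban1983to89
open Literature.MathematicalPhysics.QuantumFieldTheory.Balaban1983to89.B6RandomWalk (Triangle254 Ineq261)
open Literature.MathematicalPhysics.QuantumFieldTheory.Balaban1983to89.B6RandomWalkL2 (HasL2Majorant hasL2Majorant_mono hasL2Majorant_add)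
open Literature.MathematicalPhysics.QuantumFieldTheory.Balaban1983to89.B9Thm34Ext (toB6)
open Literature.MathematicalPhysics.QuantumFieldTheory.Balaban1983to89.B9Ineq347 (ScaleTransfer)
open Literature.MathematicalPhysics.QuantumFieldTheory.Balaban1983to89.B9Ineq366CPrime (scaleTransfer_one kappa366 kappa366_nonneg)
open Literature.MathematicalPhysics.QuantumFieldTheory.Balaban1983to89.B9Eq360Vprime (cPrime)
open Literature.MathematicalPhysics.QuantumFieldTheory.Balaban1983to89.B9Ineq363L2 (hasL2Majorant_comp_decay hasL2Majorant_rate_mono)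
open Literature.MathematicalPhysics.QuantumFieldTheory.Balaban1983to89.B9Ineq377L2 (hasL2Majorant_comp_decay_left1 hasL2Majorant_comp_decay_right1
  hasL2Majorant_local_mul hasL2Majorant_mul_local)

variable {g : B9.Geometry} [Fintype g.Site] [DecidableEq g.Site] {R : ℝ} {H : Prop} {W : Type} [Fintype W]

omit [Fintype g.Site] [DecidableEq g.Site] in
/-- Rate monotonicity of the exponential weight: `ρ ≦ r`, `t ≧ 0` ⟹ `e^{−rt} ≦ e^{−ρt}` (plumbing, as in `B9Ineq366CPrime`). [folklore] -/
private theorem exp_rate_mono {ρ r t : ℝ} (h : ρ ≤ r) (ht : 0 ≤ t) : Real.exp (-(r * t)) ≤ Real.exp (-(ρ * t)) :=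
  Real.exp_le_exp.mpr (by nlinarith)

/-- **(3.66) p. 403 from the building blocks of `C′(A)`, in the block-majorant calculus of [4]** — *"Using the results
obtained for operators building it, and Lemma 2.1 [4], in the same way as in the bounds (2.68) in [4], we get
|C′(A; y, y′)| ≦ O(1)α₁(Lʲη)⁴(L^{j′}η)^{−d}e^{−(1/2)δ₀d(y,y′)} for y ∈ Λ_j, y′ ∈ Λ_{j′}. (3.66)"*.  SETTING: all seven letters of
the p. 403 expansion are endomorphisms of the functions on ONE carrier `W` with block map `blk : W → 𝔅` (the reader takes
`W = T_η ⊕ 𝔅`: site functions and block functions side by side), and `C′(A)` is LITERALLY `B9Eq360Vprime.cPrime Q Qs F₂ F₂s G E V`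
(`Q = Q′(U)`, `Qs = Q′*(U)`, `F₂ = F′₂(A)`, `F₂s = F′₂*(A)`, `G = G′(U)`, `E = G′(U′U)`, `V = V′(A)`).  INPUTS, each of printed
shape: `hQ`/`hQs` — `Q′(U)`, `Q′*(U)` are block-local with block-sup norm `≦ κ_Q` ((3.19): averages with unitary transports,
`κ_Q = 1`); `hF`/`hFs` — (3.59) *"|(F′₂ⱼ(A)λ)(y)| ≦ O(1)α₁ …"* and *"a similar expansion for the adjoint operator"*, block-local
with norm `≦ c_F α₁`; `hG` — Theorem 3.1 (3.42)₁ for `G′(U)`: majorant `B₀(Lʲη)²e^{−δ d(y,y′)}`; `hE` — the same for `G′(U′U)`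
(*"we can prove all the statements (3.42)–(3.47) of Theorem 3.1 for the operator G′(U′U), of course with different
constants … We define new constants in such a way that the statements of Theorem 3.1 hold for extended operators"*, p. 403;
tree: `B6RandomWalkHom.b9_leftEntry_of_361_365`), constant `B₁`; `hVG`/`hVE` — (3.63) for `V′(A)G′(U)` and for `V′(A)G′(U′U)`
(tree: `B6RandomWalkHom.b9_363_of_361`), constants `c_V α₁ B₀`, `c_V α₁ B₁`; all four at a common rate `δ` (the print's
convention of re-defined constants; weaken by `hasL2Majorant_rate_mono`).  GEOMETRY ([4] Lemma 2.1 and (2.46)/(2.54)): the scale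
transfer of the p. 398 remark at exponent `α` with constant `C` for the weight `(Lʲη)²` (`C = L²` under `L²e^{−αδ₀RM} ≦ 1`,
`B9Ineq347.scaleTransfer_of_260`), (2.61) at exponent `β`, the triangle inequality, `d ≧ 0`.  CONCLUSION: for every output
rate `ρ ≧ 0` with `ρ + (α+β)δ₀ ≦ δ`, `C′(A)` has the majorant `κ₃₆₆·α₁·(Lʲη)⁴·e^{−ρ d(y,y′)}` (`kappa366`, explicit) — in the
pairing convention of 𝔅 this IS `|C′(A;y,y′)| ≦ κ₃₆₆α₁(Lʲη)⁴(L^{j′}η)^{−d}e^{−ρ d(y,y′)}` (`ineq366_kernel` below).  LOCATED: the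
printed rate `½δ₀` is `ρ = ½δ` under `α + β ≦ ½` (`hasL2Majorant_cPrime_half`); the paper's `O(1)` is `κ₃₆₆` with `κ_Q = 1`.
Route = term by term: the local letters cost their norms (`hasL2Majorant_local_mul`/`_mul_local`), each product of decaying
factors costs one scale transfer + one (2.61) + one triangle inequality per composition (`hasL2Majorant_comp_decay*`), with the
words re-associated as `E·((V′G)·G)`, `G·(G·(V′E))`, `G·((V′E)·(E·(V′G)))`.
[cite: Balaban1985BackgroundPropagators, (3.65)–(3.66) p.403 + (3.59) p.402 + (3.63) p.402 + Thm 3.1 (3.42) p.397 + p.398 remark; Balaban1984PropagatorsII, Lemma 2.1 p.234 + (2.68) p.235] -/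
theorem hasL2Majorant_cPrime (blk : W → g.Site) (d : ℕ) (δ₀ δ α β ρ C κQ cF cV B₀ B₁ α₁ : ℝ)
    (hκQ : 0 ≤ κQ) (hcF : 0 ≤ cF) (hcV : 0 ≤ cV) (hB₀ : 0 ≤ B₀) (hB₁ : 0 ≤ B₁) (hα₁ : 0 ≤ α₁) (hC : 0 ≤ C)
    (hρ : 0 ≤ ρ) (hαδ : 0 ≤ α * δ₀) (hβδ : 0 ≤ β * δ₀) (hr : ρ + (α + β) * δ₀ ≤ δ)
    (hdnn : ∀ a b : g.Site, 0 ≤ g.dist a b) (htri : Triangle254 (toB6 g R H))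
    (hST : ScaleTransfer g δ₀ α C (fun y => g.len y ^ 2)) (h261 : Ineq261 d (toB6 g R H) δ₀ β)
    {Q Qs F₂ F₂s G E V : Module.End ℝ (W → ℝ)}
    (hQ : HasL2Majorant (g := toB6 g R H) blk Q (fun a b : g.Site => if a = b then κQ else 0))
    (hQs : HasL2Majorant (g := toB6 g R H) blk Qs (fun a b : g.Site => if a = b then κQ else 0))
    (hF : HasL2Majorant (g := toB6 g R H) blk F₂ (fun a b : g.Site => if a = b then cF * α₁ else 0))
    (hFs : HasL2Majorant (g := toB6 g R H) blk F₂s (fun a b : g.Site => if a = b then cF * α₁ else 0))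
    (hG : HasL2Majorant (g := toB6 g R H) blk G (fun a b => B₀ * g.len a ^ 2 * Real.exp (-(δ * g.dist a b))))
    (hE : HasL2Majorant (g := toB6 g R H) blk E (fun a b => B₁ * g.len a ^ 2 * Real.exp (-(δ * g.dist a b))))
    (hVG : HasL2Majorant (g := toB6 g R H) blk (V * G) (fun a b => cV * α₁ * B₀ * Real.exp (-(δ * g.dist a b))))
    (hVE : HasL2Majorant (g := toB6 g R H) blk (V * E) (fun a b => cV * α₁ * B₁ * Real.exp (-(δ * g.dist a b)))) :
    HasL2Majorant (g := toB6 g R H) blk (B9Eq360Vprime.cPrime Q Qs F₂ F₂s G E V)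
      (fun a b => kappa366 κQ cF cV B₀ B₁ C (B6.c1 d δ₀ β) α₁ * α₁ * g.len a ^ 4 * Real.exp (-(ρ * g.dist a b))) := by
  have hc0 : 0 ≤ B6.c1 d δ₀ β := B6RandomWalk.c1_nonneg d δ₀ β
  have hw2 : ∀ a : g.Site, 0 ≤ g.len a ^ 2 := fun a => sq_nonneg _
  have hρδ : ρ ≤ δ := by linarith
  have hcFα : 0 ≤ cF * α₁ := mul_nonneg hcF hα₁
  -- the inputs weakened to the output rate ρ (right factors)
  have hGρ := hasL2Majorant_rate_mono (R := R) (H := H) blk B₀ (fun a => g.len a ^ 2) hB₀ hw2 hρδ hdnn hG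
  have hEρ := hasL2Majorant_rate_mono (R := R) (H := H) blk B₁ (fun a => g.len a ^ 2) hB₁ hw2 hρδ hdnn hE
  have hVGρ : HasL2Majorant (g := toB6 g R H) blk (V * G) (fun a b => cV * α₁ * B₀ * Real.exp (-(ρ * g.dist a b))) :=
    hasL2Majorant_mono (g := toB6 g R H) blk hVG fun a b =>
      mul_le_mul_of_nonneg_left (exp_rate_mono hρδ (hdnn a b)) (mul_nonneg (mul_nonneg hcV hα₁) hB₀)
  have hVEρ : HasL2Majorant (g := toB6 g R H) blk (V * E) (fun a b => cV * α₁ * B₁ * Real.exp (-(ρ * g.dist a b))) :=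
    hasL2Majorant_mono (g := toB6 g R H) blk hVE fun a b =>
      mul_le_mul_of_nonneg_left (exp_rate_mono hρδ (hdnn a b)) (mul_nonneg (mul_nonneg hcV hα₁) hB₁)
  -- G′(U′U)² (terms 1–3)
  have hEE : HasL2Majorant (g := toB6 g R H) blk (E * E)
      (fun a b => (B₁ * B₁ * C * B6.c1 d δ₀ β) * (g.len a ^ 2 * g.len a ^ 2) * Real.exp (-(ρ * g.dist a b))) :=
    hasL2Majorant_comp_decay (R := R) (H := H) blk d δ₀ α β ρ δ C B₁ B₁ (fun a => g.len a ^ 2) (fun a => g.len a ^ 2)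
      hw2 hw2 hC hB₁ hB₁ hρ hr hdnn htri hST h261 hE hEρ
  have hEE0 : ∀ a b : g.Site,
      0 ≤ (B₁ * B₁ * C * B6.c1 d δ₀ β) * (g.len a ^ 2 * g.len a ^ 2) * Real.exp (-(ρ * g.dist a b)) :=
    fun a b => by positivity
  have hT1 : HasL2Majorant (g := toB6 g R H) blk (F₂ * (E * E) * Qs)
      (fun a b => cF * α₁ * ((B₁ * B₁ * C * B6.c1 d δ₀ β) * (g.len a ^ 2 * g.len a ^ 2) *
        Real.exp (-(ρ * g.dist a b))) * κQ) :=
    hasL2Majorant_mul_local (R := R) (H := H) blk κQ (fun a b => mul_nonneg hcFα (hEE0 a b))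
      (hasL2Majorant_local_mul (R := R) (H := H) blk (cF * α₁) hcFα hF hEE) hQs
  have hT2 : HasL2Majorant (g := toB6 g R H) blk (Q * (E * E) * F₂s)
      (fun a b => κQ * ((B₁ * B₁ * C * B6.c1 d δ₀ β) * (g.len a ^ 2 * g.len a ^ 2) *
        Real.exp (-(ρ * g.dist a b))) * (cF * α₁)) :=
    hasL2Majorant_mul_local (R := R) (H := H) blk (cF * α₁) (fun a b => mul_nonneg hκQ (hEE0 a b))
      (hasL2Majorant_local_mul (R := R) (H := H) blk κQ hκQ hQ hEE) hFs
  have hT3 : HasL2Majorant (g := toB6 g R H) blk (F₂ * (E * E) * F₂s)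
      (fun a b => cF * α₁ * ((B₁ * B₁ * C * B6.c1 d δ₀ β) * (g.len a ^ 2 * g.len a ^ 2) *
        Real.exp (-(ρ * g.dist a b))) * (cF * α₁)) :=
    hasL2Majorant_mul_local (R := R) (H := H) blk (cF * α₁) (fun a b => mul_nonneg hcFα (hEE0 a b))
      (hasL2Majorant_local_mul (R := R) (H := H) blk (cF * α₁) hcFα hF hEE) hFs
  -- term 4: Q′·G′(U′U)·(V′G′(U))·G′(U)·Q′*
  have hVGG : HasL2Majorant (g := toB6 g R H) blk (V * G * G)
      (fun a b => (cV * α₁ * B₀ * B₀ * C * B6.c1 d δ₀ β) * g.len a ^ 2 * Real.exp (-(ρ * g.dist a b))) :=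
    hasL2Majorant_comp_decay_left1 (R := R) (H := H) blk d δ₀ α β ρ δ C (cV * α₁ * B₀) B₀ (fun a => g.len a ^ 2)
      hw2 hC (mul_nonneg (mul_nonneg hcV hα₁) hB₀) hB₀ hρ hr hdnn htri hST h261 hVG hGρ
  have hEVGG : HasL2Majorant (g := toB6 g R H) blk (E * (V * G * G))
      (fun a b => (B₁ * (cV * α₁ * B₀ * B₀ * C * B6.c1 d δ₀ β) * C * B6.c1 d δ₀ β) *
        (g.len a ^ 2 * g.len a ^ 2) * Real.exp (-(ρ * g.dist a b))) :=
    hasL2Majorant_comp_decay (R := R) (H := H) blk d δ₀ α β ρ δ C B₁ (cV * α₁ * B₀ * B₀ * C * B6.c1 d δ₀ β)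
      (fun a => g.len a ^ 2) (fun a => g.len a ^ 2) hw2 hw2 hC hB₁ (by positivity) hρ hr hdnn htri hST h261 hE hVGG
  have e4 : E * V * (G * G) = E * (V * G * G) := by noncomm_ring
  have hT4in : HasL2Majorant (g := toB6 g R H) blk (E * V * (G * G))
      (fun a b => (B₁ * (cV * α₁ * B₀ * B₀ * C * B6.c1 d δ₀ β) * C * B6.c1 d δ₀ β) *
        (g.len a ^ 2 * g.len a ^ 2) * Real.exp (-(ρ * g.dist a b))) := by
    rw [e4]; exact hEVGG
  have hT40 : ∀ a b : g.Site, 0 ≤ (B₁ * (cV * α₁ * B₀ * B₀ * C * B6.c1 d δ₀ β) * C * B6.c1 d δ₀ β) *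
      (g.len a ^ 2 * g.len a ^ 2) * Real.exp (-(ρ * g.dist a b)) := fun a b => by positivity
  have hT4 : HasL2Majorant (g := toB6 g R H) blk (Q * (E * V * (G * G)) * Qs)
      (fun a b => κQ * ((B₁ * (cV * α₁ * B₀ * B₀ * C * B6.c1 d δ₀ β) * C * B6.c1 d δ₀ β) *
        (g.len a ^ 2 * g.len a ^ 2) * Real.exp (-(ρ * g.dist a b))) * κQ) :=
    hasL2Majorant_mul_local (R := R) (H := H) blk κQ (fun a b => mul_nonneg hκQ (hT40 a b))
      (hasL2Majorant_local_mul (R := R) (H := H) blk κQ hκQ hQ hT4in) hQs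
  -- term 5: Q′·G′(U)·G′(U)·(V′G′(U′U))·Q′*
  have hGVE : HasL2Majorant (g := toB6 g R H) blk (G * (V * E))
      (fun a b => (B₀ * (cV * α₁ * B₁) * B6.c1 d δ₀ β) * g.len a ^ 2 * Real.exp (-(ρ * g.dist a b))) :=
    hasL2Majorant_comp_decay_right1 (R := R) (H := H) blk d δ₀ α β ρ δ B₀ (cV * α₁ * B₁) (fun a => g.len a ^ 2)
      hw2 hB₀ (mul_nonneg (mul_nonneg hcV hα₁) hB₁) hρ hαδ hr hdnn htri h261 hG hVEρ
  have hGGVE : HasL2Majorant (g := toB6 g R H) blk (G * (G * (V * E)))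
      (fun a b => (B₀ * (B₀ * (cV * α₁ * B₁) * B6.c1 d δ₀ β) * C * B6.c1 d δ₀ β) *
        (g.len a ^ 2 * g.len a ^ 2) * Real.exp (-(ρ * g.dist a b))) :=
    hasL2Majorant_comp_decay (R := R) (H := H) blk d δ₀ α β ρ δ C B₀ (B₀ * (cV * α₁ * B₁) * B6.c1 d δ₀ β)
      (fun a => g.len a ^ 2) (fun a => g.len a ^ 2) hw2 hw2 hC hB₀ (by positivity) hρ hr hdnn htri hST h261 hG hGVE
  have e5 : G * G * V * E = G * (G * (V * E)) := by noncomm_ring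
  have hT5in : HasL2Majorant (g := toB6 g R H) blk (G * G * V * E)
      (fun a b => (B₀ * (B₀ * (cV * α₁ * B₁) * B6.c1 d δ₀ β) * C * B6.c1 d δ₀ β) *
        (g.len a ^ 2 * g.len a ^ 2) * Real.exp (-(ρ * g.dist a b))) := by
    rw [e5]; exact hGGVE
  have hT50 : ∀ a b : g.Site, 0 ≤ (B₀ * (B₀ * (cV * α₁ * B₁) * B6.c1 d δ₀ β) * C * B6.c1 d δ₀ β) *
      (g.len a ^ 2 * g.len a ^ 2) * Real.exp (-(ρ * g.dist a b)) := fun a b => by positivity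
  have hT5 : HasL2Majorant (g := toB6 g R H) blk (Q * (G * G * V * E) * Qs)
      (fun a b => κQ * ((B₀ * (B₀ * (cV * α₁ * B₁) * B6.c1 d δ₀ β) * C * B6.c1 d δ₀ β) *
        (g.len a ^ 2 * g.len a ^ 2) * Real.exp (-(ρ * g.dist a b))) * κQ) :=
    hasL2Majorant_mul_local (R := R) (H := H) blk κQ (fun a b => mul_nonneg hκQ (hT50 a b))
      (hasL2Majorant_local_mul (R := R) (H := H) blk κQ hκQ hQ hT5in) hQs
  -- term 6: Q′·G′(U)·(V′G′(U′U))·G′(U′U)·(V′G′(U))·Q′*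
  have hEVG : HasL2Majorant (g := toB6 g R H) blk (E * (V * G))
      (fun a b => (B₁ * (cV * α₁ * B₀) * B6.c1 d δ₀ β) * g.len a ^ 2 * Real.exp (-(ρ * g.dist a b))) :=
    hasL2Majorant_comp_decay_right1 (R := R) (H := H) blk d δ₀ α β ρ δ B₁ (cV * α₁ * B₀) (fun a => g.len a ^ 2)
      hw2 hB₁ (mul_nonneg (mul_nonneg hcV hα₁) hB₀) hρ hαδ hr hdnn htri h261 hE hVGρ
  have hVEEVG : HasL2Majorant (g := toB6 g R H) blk (V * E * (E * (V * G)))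
      (fun a b => (cV * α₁ * B₁ * (B₁ * (cV * α₁ * B₀) * B6.c1 d δ₀ β) * C * B6.c1 d δ₀ β) * g.len a ^ 2 *
        Real.exp (-(ρ * g.dist a b))) :=
    hasL2Majorant_comp_decay_left1 (R := R) (H := H) blk d δ₀ α β ρ δ C (cV * α₁ * B₁)
      (B₁ * (cV * α₁ * B₀) * B6.c1 d δ₀ β) (fun a => g.len a ^ 2) hw2 hC (mul_nonneg (mul_nonneg hcV hα₁) hB₁)
      (by positivity) hρ hr hdnn htri hST h261 hVE hEVG
  have hGVEEVG : HasL2Majorant (g := toB6 g R H) blk (G * (V * E * (E * (V * G))))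
      (fun a b => (B₀ * (cV * α₁ * B₁ * (B₁ * (cV * α₁ * B₀) * B6.c1 d δ₀ β) * C * B6.c1 d δ₀ β) * C *
        B6.c1 d δ₀ β) * (g.len a ^ 2 * g.len a ^ 2) * Real.exp (-(ρ * g.dist a b))) :=
    hasL2Majorant_comp_decay (R := R) (H := H) blk d δ₀ α β ρ δ C B₀
      (cV * α₁ * B₁ * (B₁ * (cV * α₁ * B₀) * B6.c1 d δ₀ β) * C * B6.c1 d δ₀ β)
      (fun a => g.len a ^ 2) (fun a => g.len a ^ 2) hw2 hw2 hC hB₀ (by positivity) hρ hr hdnn htri hST h261 hG hVEEVG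
  have e6 : G * V * (E * E) * V * G = G * (V * E * (E * (V * G))) := by noncomm_ring
  have hT6in : HasL2Majorant (g := toB6 g R H) blk (G * V * (E * E) * V * G)
      (fun a b => (B₀ * (cV * α₁ * B₁ * (B₁ * (cV * α₁ * B₀) * B6.c1 d δ₀ β) * C * B6.c1 d δ₀ β) * C *
        B6.c1 d δ₀ β) * (g.len a ^ 2 * g.len a ^ 2) * Real.exp (-(ρ * g.dist a b))) := by
    rw [e6]; exact hGVEEVG
  have hT60 : ∀ a b : g.Site, 0 ≤ (B₀ * (cV * α₁ * B₁ * (B₁ * (cV * α₁ * B₀) * B6.c1 d δ₀ β) * C * B6.c1 d δ₀ β) *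
      C * B6.c1 d δ₀ β) * (g.len a ^ 2 * g.len a ^ 2) * Real.exp (-(ρ * g.dist a b)) := fun a b => by positivity
  have hT6 : HasL2Majorant (g := toB6 g R H) blk (Q * (G * V * (E * E) * V * G) * Qs)
      (fun a b => κQ * ((B₀ * (cV * α₁ * B₁ * (B₁ * (cV * α₁ * B₀) * B6.c1 d δ₀ β) * C * B6.c1 d δ₀ β) * C *
        B6.c1 d δ₀ β) * (g.len a ^ 2 * g.len a ^ 2) * Real.exp (-(ρ * g.dist a b))) * κQ) :=
    hasL2Majorant_mul_local (R := R) (H := H) blk κQ (fun a b => mul_nonneg hκQ (hT60 a b))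
      (hasL2Majorant_local_mul (R := R) (H := H) blk κQ hκQ hQ hT6in) hQs
  -- the sum
  have hsum := hasL2Majorant_add (g := toB6 g R H) blk (hasL2Majorant_add (g := toB6 g R H) blk
    (hasL2Majorant_add (g := toB6 g R H) blk (hasL2Majorant_add (g := toB6 g R H) blk
    (hasL2Majorant_add (g := toB6 g R H) blk hT1 hT2) hT3) hT4) hT5) hT6
  unfold B9Eq360Vprime.cPrime
  refine hasL2Majorant_mono (g := toB6 g R H) blk hsum fun a b => le_of_eq ?_
  simp only [kappa366]
  ring

/-- **(3.66) at the printed rate `½`**: under `α + β ≦ ½` (and `δ ≧ 0` the common input rate, Lemma 2.1 taken with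
`δ₀ = δ`), the output rate may be taken `ρ = ½δ` — the printed *"e^{−(1/2)δ₀d(y,y′)}"* in the paper's convention that
`G′(U′U)` obeys Theorem 3.1 with the re-defined `δ₀`. [cite: Balaban1985BackgroundPropagators, (3.66) p.403] -/
theorem hasL2Majorant_cPrime_half (blk : W → g.Site) (d : ℕ) (δ α β C κQ cF cV B₀ B₁ α₁ : ℝ)
    (hκQ : 0 ≤ κQ) (hcF : 0 ≤ cF) (hcV : 0 ≤ cV) (hB₀ : 0 ≤ B₀) (hB₁ : 0 ≤ B₁) (hα₁ : 0 ≤ α₁) (hC : 0 ≤ C)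
    (hδ : 0 ≤ δ) (hα : 0 ≤ α) (hβ : 0 ≤ β) (hαβ : α + β ≤ 1 / 2)
    (hdnn : ∀ a b : g.Site, 0 ≤ g.dist a b) (htri : Triangle254 (toB6 g R H))
    (hST : ScaleTransfer g δ α C (fun y => g.len y ^ 2)) (h261 : Ineq261 d (toB6 g R H) δ β)
    {Q Qs F₂ F₂s G E V : Module.End ℝ (W → ℝ)}
    (hQ : HasL2Majorant (g := toB6 g R H) blk Q (fun a b : g.Site => if a = b then κQ else 0))
    (hQs : HasL2Majorant (g := toB6 g R H) blk Qs (fun a b : g.Site => if a = b then κQ else 0))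
    (hF : HasL2Majorant (g := toB6 g R H) blk F₂ (fun a b : g.Site => if a = b then cF * α₁ else 0))
    (hFs : HasL2Majorant (g := toB6 g R H) blk F₂s (fun a b : g.Site => if a = b then cF * α₁ else 0))
    (hG : HasL2Majorant (g := toB6 g R H) blk G (fun a b => B₀ * g.len a ^ 2 * Real.exp (-(δ * g.dist a b))))
    (hE : HasL2Majorant (g := toB6 g R H) blk E (fun a b => B₁ * g.len a ^ 2 * Real.exp (-(δ * g.dist a b))))
    (hVG : HasL2Majorant (g := toB6 g R H) blk (V * G) (fun a b => cV * α₁ * B₀ * Real.exp (-(δ * g.dist a b))))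
    (hVE : HasL2Majorant (g := toB6 g R H) blk (V * E) (fun a b => cV * α₁ * B₁ * Real.exp (-(δ * g.dist a b)))) :
    HasL2Majorant (g := toB6 g R H) blk (B9Eq360Vprime.cPrime Q Qs F₂ F₂s G E V)
      (fun a b => kappa366 κQ cF cV B₀ B₁ C (B6.c1 d δ β) α₁ * α₁ * g.len a ^ 4 *
        Real.exp (-(δ / 2 * g.dist a b))) :=
  hasL2Majorant_cPrime (R := R) (H := H) blk d δ δ α β (δ / 2) C κQ cF cV B₀ B₁ α₁ hκQ hcF hcV hB₀ hB₁ hα₁ hC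
    (by linarith) (mul_nonneg hα hδ) (mul_nonneg hβ hδ) (by nlinarith) hdnn htri hST h261 hQ hQs hF hFs hG hE hVG hVE




/-! ## §2  (3.49) for the SANDWICHED word of the frames: `P = G′·M·G′` with `M = Q′*·(Q′G′²Q′*)⁻¹·Q′` read as ONE letter -/

/-- ★ **(3.49) IN BLOCK-ℓ² FOR THE SANDWICHED WORD `P(U) = G′·M·G′`, `M = Q′*(Q′G′²Q′*)⁻¹Q′`** (the shape of the frames' `R(U) = Gop ∘ (Qcs ∘ Cop ∘ Qc) ∘ Gop`,
`B9SectBGStepAtLettersV2.GFrame₂.gb_eq`; `M`'s block-ℓ² size `B_M(Lʲη)⁻⁴e^{−δd}` is what `B6RandomWalkL2Hom.hasL2Majorant_sandwich` produces from the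
(3.48) entries and the ℓ² sizes of `Q′, Q′*`): `B9Ineq377L2.ineq349_l2` at `Q = Q* = 1` (`κ_Q = 1`, `B6RandomWalkL2.hasL2Majorant_one`) gives the four entries
`κ₃₄₉(1, B₀, B_M, Λ, c)·[1, (Lʲη)⁻¹, (Lʲη)⁻¹, (Lʲη)⁻²]·e^{−ρd}` of `G·M·G`, `D·(G·M·G)`, `G·M·G·Ds`, `D·(G·M·G)·Ds` for `ρ + (2α+β)δ₀ ≦ δ`.
[cite: Balaban1985BackgroundPropagators, (3.25) p.394 + Thm 3.1 (3.46) p.398 + Thm 3.2 (3.48) p.398 + (3.49) p.399; Balaban1984PropagatorsII, Lemma 2.1 p.234 + Prop. 2.6 (2.140) p.247] -/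
theorem ineq349_l2_sandwich (blk : W → g.Site) (d : ℕ) (δ₀ δ α β ρ Λ B₀ BM : ℝ)
    (hB₀ : 0 ≤ B₀) (hBM : 0 ≤ BM) (hΛ : 1 ≤ Λ) (hρ : 0 ≤ ρ) (hα : 0 ≤ α) (hβ : 0 ≤ β)
    (hδ₀ : 0 ≤ δ₀) (hr : ρ + (2 * α + β) * δ₀ ≤ δ)
    (hdnn : ∀ a b : g.Site, 0 ≤ g.dist a b) (htri : Triangle254 (toB6 g R H)) (hlen : ∀ y : g.Site, 0 < g.len y)
    (h261 : Ineq261 d (toB6 g R H) δ₀ β)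
    (hT1 : ScaleTransfer g δ₀ α Λ (fun a => g.len a)) (hT2 : ScaleTransfer g δ₀ α Λ (fun a => g.len a ^ 2))
    (hT4 : ScaleTransfer g δ₀ α Λ (fun a => (g.len a ^ 4)⁻¹))
    {G D Ds M : Module.End ℝ (W → ℝ)}
    (hG : HasL2Majorant (g := toB6 g R H) blk G (fun a b => B₀ * g.len a ^ 2 * Real.exp (-(δ * g.dist a b))))
    (hDG : HasL2Majorant (g := toB6 g R H) blk (D * G) (fun a b => B₀ * g.len a * Real.exp (-(δ * g.dist a b))))
    (hGDs : HasL2Majorant (g := toB6 g R H) blk (G * Ds) (fun a b => B₀ * g.len a * Real.exp (-(δ * g.dist a b))))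
    (hM : HasL2Majorant (g := toB6 g R H) blk M (fun a b => BM * (g.len a ^ 4)⁻¹ * Real.exp (-(δ * g.dist a b)))) :
    HasL2Majorant (g := toB6 g R H) blk (G * M * G)
        (fun a b => B9Ineq368PPrime.kappa349 1 B₀ BM Λ (B6.c1 d δ₀ β) * Real.exp (-(ρ * g.dist a b))) ∧
      HasL2Majorant (g := toB6 g R H) blk (D * (G * M * G))
        (fun a b => B9Ineq368PPrime.kappa349 1 B₀ BM Λ (B6.c1 d δ₀ β) * (g.len a)⁻¹ * Real.exp (-(ρ * g.dist a b))) ∧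
      HasL2Majorant (g := toB6 g R H) blk (G * M * G * Ds)
        (fun a b => B9Ineq368PPrime.kappa349 1 B₀ BM Λ (B6.c1 d δ₀ β) * (g.len a)⁻¹ * Real.exp (-(ρ * g.dist a b))) ∧
      HasL2Majorant (g := toB6 g R H) blk (D * (G * M * G) * Ds)
        (fun a b => B9Ineq368PPrime.kappa349 1 B₀ BM Λ (B6.c1 d δ₀ β) * (g.len a ^ 2)⁻¹ * Real.exp (-(ρ * g.dist a b))) := by
  have h1 : HasL2Majorant (g := toB6 g R H) blk (1 : Module.End ℝ (W → ℝ)) (fun a b : g.Site => if a = b then (1 : ℝ) else 0) :=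
    B6RandomWalkL2.hasL2Majorant_one (g := toB6 g R H) blk (fun y => by simp) (fun a b => by split_ifs <;> norm_num)
  obtain ⟨e1, e2, e3, e4⟩ := B9Ineq377L2.ineq349_l2 (R := R) (H := H) blk d δ₀ δ α β ρ Λ 1 B₀ BM zero_le_one hB₀ hBM hΛ hρ hα hβ
    hδ₀ hr hdnn htri hlen h261 hT1 hT2 hT4 h1 h1 hG hDG hGDs hM
  simp only [B9Eq360Vprime.pOp, mul_one] at e1 e2 e3 e4
  exact ⟨e1, e2, e3, e4⟩

end Literature.MathematicalPhysics.QuantumFieldTheory.Balaban1983to89.B9Ineq366L2
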